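import Summits.CriticalPhenomena.CardyFormulaZ2.Theorems.CardySegmentWeakRSWClosedOfWeakBoxCrossingSpecialises
import Literature.Probability.Percolation.IsoradialProofs
import HarnessLib

/-!
# Route `CardySegmentWeakRSW`, crux `WeakBoxCrossing` (stmt-CriticalPhenomena-18422): the pointwise dial and the `ℤ²` endpoint

* `weakBoxCrossingAt_of_hasBoxCrossingProperty` — POINTWISE form of the dial of
  `CardySegmentWeakRSWClosedOfWeakBoxCrossingSpecialises.lean`: if a single corner model `M_t` has the
  box-crossing (RSW) property, then weak box crossing holds AT `t` (some `c > 0` such that at arbitrarily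
  small meshes the crude bottom-to-top `M_t`-crossing probability of `(0,2) × (0,1)` is `≤ 1 - c`); same
  forced-gate argument (`exists_embTBCrossing_of_crude_two_by_one` + the bound at aspect ratio `¼`).
* `weakBoxCrossing_at_one` — the `t = 1` instance of the crux `WeakBoxCrossing` HOLDS: `M_1` is critical
  bond percolation on `ℤ²` (`cornerPercolation_one`), which has the box-crossing property
  (`square_boxCrossing_holds`, Russo–Seymour–Welsh via Grimmett–Manolescu). So the crux is decided at the
  `ℤ²` end of the segment; its content is the interior `t ∈ (0,1)` (and `t = 0`).

prover-fwd2-land-1-0, 2026-08-18. [folklore]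
-/

noncomputable section

open Set Filter Metric MeasureTheory Complex
open scoped Topology
open Literature.Probability.RandomPlanarGeometry Literature.Probability.Percolation
open Literature.Probability.LatticeModels
open Summit.CriticalPhenomena.CardyFormulaZ2.Cruxes.SegmentClosed.Sketch (cornerPercolation_real_le_of_edgeSet)

namespace Summit.CriticalPhenomena.CardyFormulaZ2.Theorems

/-- **Pointwise dial.** Box crossing for ONE corner model `M_t` gives weak box crossing at `t`:
with the box-crossing constant `c` at aspect ratio `¼` and meshes `δ = 1/n`, `n ≥ max 16 n₀`, `n > 1/δ₀`,
the crude crossing of `(0,2) × (0,1)` lies in a top–bottom crossing of a `2n × n/2` lattice box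
(`exists_embTBCrossing_of_crude_two_by_one`), of `M_t`-probability `≤ 1 - c`. [folklore] -/
theorem weakBoxCrossingAt_of_hasBoxCrossingProperty (t : unitInterval)
    (h : HasBoxCrossingProperty (cornerPercolation t) squareLatticeEmbedding.z) :
    ∃ c > 0, ∀ δ₀ : ℝ, 0 < δ₀ → ∃ δ : ℝ, 0 < δ ∧ δ < δ₀ ∧
      cornerCrossingProb t (rectQuad 0 2 0 1 two_pos one_pos) δ ≤ 1 - c := by
  obtain ⟨c, hc, n₀, hB⟩ := h (1 / 4) (by norm_num)
  refine ⟨c, hc, fun δ₀ hδ₀ => ?_⟩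
  obtain ⟨n, hn⟩ := exists_nat_gt (max 16 (max (n₀ : ℝ) δ₀⁻¹))
  have h16 : (16 : ℝ) < n := lt_of_le_of_lt (le_max_left _ _) hn
  have hn₀ : (n₀ : ℝ) < n := lt_of_le_of_lt ((le_max_left _ _).trans (le_max_right _ _)) hn
  have hδ₀n : δ₀⁻¹ < n := lt_of_le_of_lt ((le_max_right _ _).trans (le_max_right _ _)) hn
  have hn0 : (0 : ℝ) < n := by linarith
  have h16' : 16 ≤ n := by exact_mod_cast h16.le
  have hN : n₀ ≤ 2 * n := by
    have : n₀ < n := by exact_mod_cast hn₀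
    omega
  refine ⟨(n : ℝ)⁻¹, inv_pos.2 hn0, ?_, ?_⟩
  · rwa [inv_lt_comm₀ hn0 hδ₀]
  · obtain ⟨w, hw⟩ := exists_embTBCrossing_of_crude_two_by_one h16'
    obtain ⟨-, -, hup⟩ := hB (2 * n) hN w
    rw [cornerCrossingProb_eq]
    exact (cornerPercolation_real_le_of_edgeSet t hw).trans hup

/-- **Weak box crossing holds at the `ℤ²` endpoint `t = 1`.** `M_1 = P_{1/2}` bond percolation on `ℤ²`
(`cornerPercolation_one`) has the box-crossing property (`square_boxCrossing_holds`), so the `t = 1`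
instance of the crux `WeakBoxCrossing` (stmt-CriticalPhenomena-18422) is a theorem. [folklore] -/
theorem weakBoxCrossing_at_one :
    ∃ c > 0, ∀ δ₀ : ℝ, 0 < δ₀ → ∃ δ : ℝ, 0 < δ ∧ δ < δ₀ ∧
      cornerCrossingProb 1 (rectQuad 0 2 0 1 two_pos one_pos) δ ≤ 1 - c := by
  refine weakBoxCrossingAt_of_hasBoxCrossingProperty 1 ?_
  rw [cornerPercolation_one]
  exact square_boxCrossing_holds

end Summit.CriticalPhenomena.CardyFormulaZ2.Theorems

end
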